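import Summits.BirchSwinnertonDyer.BirchSwinnertonDyer.Theorems.RamifiedSevenEllipticUnitsStrictControlEulerChar
import Summits.BirchSwinnertonDyer.BirchSwinnertonDyer.Theorems.RamifiedSevenEllipticUnitsStrictControlExactControl
import Summits.BirchSwinnertonDyer.BirchSwinnertonDyer.Theorems.RamifiedSevenEllipticUnitsStrictControlLocalAway
import Summits.BirchSwinnertonDyer.BirchSwinnertonDyer.Theorems.RamifiedSevenEllipticUnitsStrictControlLocalAtSeven
import HarnessLib

set_option linter.dupNamespace false
set_option autoImplicit false

/-!
# Route `RamifiedSevenEllipticUnits` (rung K7r), crux `StrictControlSeven` (stmt-BirchSwinnertonDyer-19145):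
# the crux IS the `K → ℚ` twist-descent identity for Castella's bottom Selmer group — memo O11 §3
# Steps 2 and 3 and both local inputs are now kernel theorems; Step 1 is what remains

Cell `bsd-cm`, seat `bsd-cm-k7r-c4` (g0). HONEST FRAMING: nothing here closes the crux; BSD is not
proved by any of this; no named fact is used or minted. This file COMPOSES the seat's four landed
files:

* `…StrictControlEulerChar` — (R-ctrl) ⟺ (R-ctrl)♭: `log₇ #H⁰(Γ, Sel_𝔭(K^ac_∞, E[7^∞])) =
  log₇ #Sel_str(W/ℚ)[7^∞] + log₇ #Sel_str(W'/ℚ)[7^∞]` (Step 3, Greenberg's Lemma 4.2 on the dual pair);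
* `…StrictControlExactControl` — `#H⁰(Γ, Sel_𝔭(K_∞, E[p^∞])) = #Sel_𝔭(K, E[p^∞])` from two local
  no-`p`-torsion statements (Step 2, exact control);
* `…StrictControlLocalAway` — the away-from-`7` input on 𝒞₇ (good or no `7`-torsion at `v ∤ 7`);
* `…StrictControlLocalAtSeven` — the input at the ramified prime on 𝒞₇ (`E(K_𝔭)[7] = 0`, BKNO (3.16)).

## What is proved

* `strictControl_frame_natCard_eq_of_classCSeven` — for `W ∈ 𝒞₇`, a frame `(K, 𝔭, W', C)` at `7`,
  ANY `ℤ_7`-extension `κ` of `K` with topological generator `γ`: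
  `#H⁰(Γ, Sel_𝔭(K_∞, E[7^∞])) = #Sel_𝔭(K, E[7^∞])` and the corresponding finiteness equivalence —
  UNCONDITIONAL (both local inputs discharged).
* **`strictControlSeven_iff_descent`** — the route item `StrictControlSeven` is EQUIVALENT to the
  DESCENT IDENTITY (D): at every `W ∈ 𝒞₇`, frame, anticyclotomic `κ`, `γ`, generator data (the
  crux's own binders): `Sel_𝔭(K, E[7^∞])` finite ⟹
  `log₇ #Sel_𝔭(K, E[7^∞]) = log₇ #Sel_str(W/ℚ)[7^∞] + log₇ #Sel_str(W'/ℚ)[7^∞]`, where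
  `Sel_𝔭(K, E[7^∞]) = X11b.AcSelmer.selmerAcBase (W.baseChange K) 7 𝔭 ∅` is Castella's Selmer group
  OVER `K` (strict at the unique prime `𝔭 ∣ 7`, locally trivial at every `v ∤ 7`) and
  `Sel_str(·/ℚ)[7^∞] = strictSelmerPInfty · 7`. No Iwasawa algebra, no tower, no local input remains:
  the crux is the quadratic-twist descent `Sel_𝔭(K, E[7^∞]) ≅ Sel_str(E/ℚ)[7^∞] ⊕ Sel_str(E^{(−7)}/ℚ)[7^∞]`
  for `K = ℚ(√−7)`, `7` odd (memo O11 §3 Step 1; Dokchitser–Dokchitser 2010 Lemma 4.14 mechanism,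
  tree `H1CorestrictionIndexTwo.IndexTwoDecompositionData`).
* **`strictControlSeven_of_descent`** — the binder-light sufficient form: if for every `W ∈ 𝒞₇` and
  every frame `(K, 𝔭, W', C)` at `7` with `r_an(W) = 1`, `Sel_𝔭(K, E[7^∞])` finite implies the
  displayed identity, then `StrictControlSeven`.

References: [GreenbergLNM1716] §3–§4; [Castella2018] Def. 2.2 (arXiv:1704.06608 p. 5);
[DokchitserDokchitserAnnals2010] Lemma 4.14 (the descent mechanism; shape only);
[BurungaleKobayashiNakamuraOta2026] (3.16), Thm. 6.1 (arXiv:2608.06879; shape only).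
-/

noncomputable section

open scoped Classical

open WeierstrassCurve NumberField IsDedekindDomain Field
  Literature.NumberTheory.EllipticCurves
  Literature.NumberTheory.EllipticCurves.Rank1Residual
  Literature.NumberTheory.GaloisRepresentations
  Summit.BirchSwinnertonDyer.Rank1Residual
  Summit.BirchSwinnertonDyer.Rank1Residual.Additive
  Summit.BirchSwinnertonDyer.Rank1Residual.X11b
  Summit.BirchSwinnertonDyer.Rank1Residual.X11b.AcSelmer

namespace Summit.BirchSwinnertonDyer.BirchSwinnertonDyer.Theorems.RamifiedSevenEllipticUnits

/-! ## §1 Exact control on 𝒞₇, unconditionally -/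

section Frame

variable {W : WeierstrassCurve ℚ} [W.IsElliptic] [W.IsGloballyMinimal] [Fact (Nat.Prime 7)]
  {K : Type} [Field K] [NumberField K] {𝔭 : HeightOneSpectrum (𝓞 K)}
  {W' : WeierstrassCurve ℚ} [W'.IsElliptic] [W'.IsGloballyMinimal] {C : VariableChange ℚ}

/-- **Exact control at `7` on 𝒞₇, UNCONDITIONAL.** For a global minimal `W ∈ 𝒞₇`, a frame
`(K, 𝔭, W', C)` at `7`, any `ℤ_7`-extension `κ` of `K` and topological generator `γ`:
`#H⁰(Γ, Sel_𝔭(K_∞, E[7^∞])) = #Sel_𝔭(K, E[7^∞])` (both local inputs of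
`strictControl_frame_natCard_eq` discharged by `noSevenTorsion_adicCompletion_of_classCSeven` and
`good_or_noSevenTorsion_of_classCSeven`). [cite: GreenbergLNM1716, §3 Thm. 1.2 and p. 90] -/
theorem strictControl_frame_natCard_eq_of_classCSeven (hC : X12.ClassCSeven W)
    (hF : X12.O11.IsFrame W 7 K 𝔭 W' C) (κ : ZpExtension K 7) (γ : absoluteGaloisGroup K)
    [Fact (κ.IsTopGenerator γ)] :
    Nat.card (IwasawaDual.endInvariants
        (Castella2018.AcSelmer.conjSelmerAc (W.baseChange K) 7 κ 𝔭 ∅ γ - 1)) =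
      Nat.card (selmerAcBase (W.baseChange K) 7 𝔭 ∅) :=
  strictControl_frame_natCard_eq hF κ γ (noSevenTorsion_adicCompletion_of_classCSeven W hC hF)
    (good_or_noSevenTorsion_of_classCSeven W hC hF)

/-- … and `H⁰(Γ, Sel_𝔭(K_∞, E[7^∞]))` is finite iff `Sel_𝔭(K, E[7^∞])` is.
[cite: GreenbergLNM1716, §3 Thm. 1.2] -/
theorem strictControl_frame_finite_iff_of_classCSeven (hC : X12.ClassCSeven W)
    (hF : X12.O11.IsFrame W 7 K 𝔭 W' C) (κ : ZpExtension K 7) (γ : absoluteGaloisGroup K)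
    [Fact (κ.IsTopGenerator γ)] :
    Finite (IwasawaDual.endInvariants
        (Castella2018.AcSelmer.conjSelmerAc (W.baseChange K) 7 κ 𝔭 ∅ γ - 1)) ↔
      Finite (selmerAcBase (W.baseChange K) 7 𝔭 ∅) := by
  haveI : IsTotallyComplex K := hF.2.2.2.1.2
  haveI : (W.baseChange K).IsElliptic := by rw [baseChange]; infer_instance
  exact finite_endInvariants_iff_finite_selmerAcBase_of_noPTorsion (W.baseChange K) 7 κ 𝔭 γ
    (noSevenTorsion_adicCompletion_of_classCSeven W hC hF)
    (good_or_noSevenTorsion_of_classCSeven W hC hF)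

end Frame

/-! ## §2 The crux IS the descent identity -/

/-- **`StrictControlSeven` ⟺ the descent identity (D)** (same binders as the crux): for every global
minimal `W ∈ 𝒞₇`, frame at `7` with `r_an(W) = 1`, anticyclotomic `κ`, `γ`, generator data,
`Sel_𝔭(K, E[7^∞])` finite ⟹
`log₇ #Sel_𝔭(K, E[7^∞]) = log₇ #Sel_str(W/ℚ)[7^∞] + log₇ #Sel_str(W'/ℚ)[7^∞]`. The anticyclotomic
tower has left the statement entirely. [cite: GreenbergLNM1716, §3 Thm. 1.2 and §4 Lemma 4.2] [cite: Castella2018, Def. 2.2 (arXiv:1704.06608 p. 5)] -/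
theorem strictControlSeven_iff_descent :
    Summit.BirchSwinnertonDyer.BirchSwinnertonDyer.Theses.RamifiedSevenEllipticUnits.StrictControlSeven ↔
      ∀ (W : WeierstrassCurve ℚ) [W.IsElliptic] [W.IsGloballyMinimal] [Fact (Nat.Prime 7)],
        X12.ClassCSeven W →
      ∀ (K : Type) [Field K] [NumberField K] (𝔭 : HeightOneSpectrum (𝓞 K))
        (W' : WeierstrassCurve ℚ) [W'.IsElliptic] [W'.IsGloballyMinimal] (C : VariableChange ℚ),
        X12.O11.IsFrame W 7 K 𝔭 W' C → W.analyticRank = 1 →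
        ∀ (κ : ZpExtension K 7), κ.IsAnticyclotomic →
          ∀ (γ : absoluteGaloisGroup K) [Fact (κ.IsTopGenerator γ)]
            (P : W.toAffine.Point) (n : ℕ) (P' : W'.toAffine.Point) (n' : ℕ),
            ¬ IsOfFinAddOrder P →
            (∀ R : W.toAffine.Point, ∃ (k : ℤ) (T : W.toAffine.Point),
              IsOfFinAddOrder T ∧ R = k • P + T) →
            (∀ Q : (W.baseChange ℚ_[7]).toAffine.Point, 7 • Q = 0 → Q = 0) →
            (∃ Q : (W.baseChange ℚ_[7]).toAffine.Point, 7 ^ n • Q = W.toPadicPoint 7 P) →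
            (∀ Q : (W.baseChange ℚ_[7]).toAffine.Point, 7 ^ (n + 1) • Q ≠ W.toPadicPoint 7 P) →
            ¬ IsOfFinAddOrder P' →
            (∀ R : W'.toAffine.Point, ∃ (k : ℤ) (T : W'.toAffine.Point),
              IsOfFinAddOrder T ∧ R = k • P' + T) →
            (∀ Q : (W'.baseChange ℚ_[7]).toAffine.Point, 7 • Q = 0 → Q = 0) →
            (∃ Q : (W'.baseChange ℚ_[7]).toAffine.Point, 7 ^ n' • Q = W'.toPadicPoint 7 P') →
            (∀ Q : (W'.baseChange ℚ_[7]).toAffine.Point,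
              7 ^ (n' + 1) • Q ≠ W'.toPadicPoint 7 P') →
            Finite (selmerAcBase (W.baseChange K) 7 𝔭 ∅) →
              padicValNat 7 (Nat.card (selmerAcBase (W.baseChange K) 7 𝔭 ∅)) =
                padicValNat 7 (Nat.card ↥(strictSelmerPInfty W 7)) +
                  padicValNat 7 (Nat.card ↥(strictSelmerPInfty W' 7)) := by
  rw [strictControlSeven_iff_card]
  refine ⟨fun h W _ _ _ hC K _ _ 𝔭 W' _ _ C hF hr κ hκ γ _ P n P' n' h1 h2 h3 h4 h5 h6 h7 h8 h9 h10
      hfin ↦ ?_,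
    fun h W _ _ _ hC K _ _ 𝔭 W' _ _ C hF hr κ hκ γ _ P n P' n' h1 h2 h3 h4 h5 h6 h7 h8 h9 h10
      hfin ↦ ?_⟩
  · rw [← strictControl_frame_natCard_eq_of_classCSeven hC hF κ γ]
    exact h W hC K 𝔭 W' C hF hr κ hκ γ P n P' n' h1 h2 h3 h4 h5 h6 h7 h8 h9 h10
      ((strictControl_frame_finite_iff_of_classCSeven hC hF κ γ).mpr hfin)
  · rw [strictControl_frame_natCard_eq_of_classCSeven hC hF κ γ]
    exact h W hC K 𝔭 W' C hF hr κ hκ γ P n P' n' h1 h2 h3 h4 h5 h6 h7 h8 h9 h10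
      ((strictControl_frame_finite_iff_of_classCSeven hC hF κ γ).mp hfin)

/-- **The binder-light sufficient form.** If for every global minimal `W ∈ 𝒞₇` and every frame
`(K, 𝔭, W', C)` at `7` with `r_an(W) = 1`, finiteness of Castella's Selmer group over `K` implies
`log₇ #Sel_𝔭(K, E[7^∞]) = log₇ #Sel_str(W/ℚ)[7^∞] + log₇ #Sel_str(W'/ℚ)[7^∞]`, then crux #4
`StrictControlSeven` holds. This is the target a prover of memo Step 1 (twist descent) closes.
[cite: GreenbergLNM1716, §3 Thm. 1.2 and §4 Lemma 4.2] [cite: DokchitserDokchitserAnnals2010, Lemma 4.14 (mechanism; shape only)] -/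
theorem strictControlSeven_of_descent
    (h : ∀ (W : WeierstrassCurve ℚ) [W.IsElliptic] [W.IsGloballyMinimal] [Fact (Nat.Prime 7)],
        X12.ClassCSeven W →
      ∀ (K : Type) [Field K] [NumberField K] (𝔭 : HeightOneSpectrum (𝓞 K))
        (W' : WeierstrassCurve ℚ) [W'.IsElliptic] [W'.IsGloballyMinimal] (C : VariableChange ℚ),
        X12.O11.IsFrame W 7 K 𝔭 W' C → W.analyticRank = 1 →
        Finite (selmerAcBase (W.baseChange K) 7 𝔭 ∅) →
          padicValNat 7 (Nat.card (selmerAcBase (W.baseChange K) 7 𝔭 ∅)) =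
            padicValNat 7 (Nat.card ↥(strictSelmerPInfty W 7)) +
              padicValNat 7 (Nat.card ↥(strictSelmerPInfty W' 7))) :
    Summit.BirchSwinnertonDyer.BirchSwinnertonDyer.Theses.RamifiedSevenEllipticUnits.StrictControlSeven :=
  strictControlSeven_iff_descent.mpr fun W _ _ _ hC K _ _ 𝔭 W' _ _ C hF hr _ _ _ _ _ _ _ _ _ _ _ _ _ _
    _ _ _ _ hfin ↦ h W hC K 𝔭 W' C hF hr hfin

end Summit.BirchSwinnertonDyer.BirchSwinnertonDyer.Theorems.RamifiedSevenEllipticUnits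

end
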